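import Summits.BirchSwinnertonDyer.BirchSwinnertonDyer.Theorems.LeadingTermTamePinchR
import HarnessLib

/-!
# Line `Sketch` — skeleton for crux `TamePinchR` (stmt-BirchSwinnertonDyer-17007), route `LeadingTerm`

Crux (support, conjecture-grade, rev 6): every NON-CM elliptic `E/ℚ` (globally minimal `W`) has an
admissible prime `p` (good ordinary, `p ≥ 5`, `ρ̄_{E,p}` onto), a newform `f` of `W` and a
square-free product `n` of `r = rank_ℤ E(ℚ)` Kolyvagin primes whose mod-`p` Kurihara number
`δ_n = ∑_{a ∈ (ℤ/n)ˣ} [a/n]⁺_f ∏_ℓ ψ_ℓ(a)` is non-zero for some surjective discrete logarithms `ψ_ℓ`.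

## State after cycle 1 (lead `prover-line-stmt-BirchSwinnertonDyer-17007-0`, 2026-08-16)

The line drives the COMMON TAIL of both round-1 idea compositions (`analytic-sha-pin`,
`tame-leading-term-chebotarev`): prime by prime the crux is C.-H. Kim's mod-`p` rank certificate
(arXiv:2203.12159 Thm. 1.11 with Cor. 1.6: at an admissible `p` with Kim's side conditions and
`Ш(E)[p] = 0` there is `n ∈ 𝒩₁` with `ν(n) = rank` and `δ_n ≢ 0`). LANDED (all sorry-free, tree):

* `Theorems/LeadingTermTamePinchR.lean` (p132014): the composition
  `tamePinchR_of_facts : exists_isNewformOf → Kim2022_kuriharaNumber_certificate →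
  ShaFiniteConjecture → TamePinchR`, and (p132194) `tamePinchR_of_shaTorsionCofinite`, the same with
  the finiteness of `Ш` weakened to the per-curve input actually consumed, "`Ш(W)[p] = 0` for all `p`
  outside a finite set, for every non-CM `W`";
* its four stubs `stub_admissibleSupply` (p131549: Serre open image + Chebotarev in `ℚ(E[3])`,
  cofinally many good ordinary non-anomalous `p` with surjective `ρ̄_{E,p}` for non-CM `E`),
  `stub_shaTorsionCofinite` (p131076: finite `Ш` ⇒ `Ш[p] = 0` for almost all `p`),
  `stub_localTorsionTrivial` (p131385: `a_p ≢ 1 ⇒ E(ℚ_p)[p] = 0`), `stub_maninPeriodCofinite`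
  (p131530: Manin constant and `Ω(W)/Ω⁺_f` are `p`-units for almost all `p`);
* the named fact `Literature/NumberTheory/EllipticCurves/KuriharaNumberKimCertificate.lean`
  (p131756, `Kim2022_kuriharaNumber_certificate`, faithful to print — refuter pass `Disproof.lean` §4).

What remains are NOT proof obligations of this line: the two registered stubs below are literature
debt (the Modularity Theorem `exists_isNewformOf`, tier-0 debt of every BSD route; Kim's theorem),
declared as stubs only because the skeleton checker admits registered obligations alone as
hypotheses, and the one hypothesis `ShaFiniteConjecture` is the tree's registered open conjecture
(Tate 1974). Granting the two theorems in print, the crux is EXACTLY the slice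
"`Ш(E/ℚ)[p] = 0` at one admissible prime for every non-CM `E/ℚ`" (⇐ finiteness of `Ш`; it implies
Mordell–Weil parity for all non-CM curves, `Disproof.lean` §"Why the crux resists"), i.e. open from
rank 2 on.

`tamePinchR_of_shaFinite (hSha : ShaFiniteConjecture) : TamePinchR` concludes the crux BY NAME.
-/

set_option linter.dupNamespace false

noncomputable section

namespace Summit.BirchSwinnertonDyer.BirchSwinnertonDyer.Theorems

open Literature.NumberTheory.EllipticCurves Literature.NumberTheory.EllipticCurves.ModularForms
open Summit.BirchSwinnertonDyer.BirchSwinnertonDyer.Theses.LeadingTerm (TamePinchR)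

/-! ### The two remaining registered stubs (literature debt) -/

/-- Stub **M** (the Modularity Theorem; literature debt). Every elliptic `W/ℚ` has a newform `f`
of level `N_W` with `a_n(f) = a_n(W)` (Wiles 1995, Taylor–Wiles 1995, Breuil–Conrad–Diamond–Taylor
2001 Thm. A): the tree's named fact `exists_isNewformOf`, verbatim (tier-0 debt of every BSD route;
it IS the `∃ f, IsNewformOf W f` the crux asserts, so no proof of the crux avoids it).
[cite: BCDTJAMS2001, Thm. A] -/
theorem stub_modularity : exists_isNewformOf := by
  sorry

/-- Stub **K** (Kim's mod-`p` rank certificate; literature debt): the Literature named fact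
`Kim2022_kuriharaNumber_certificate` (arXiv:2203.12159 Thm. 1.11 + Cor. 1.6; file
`KuriharaNumberKimCertificate`, p131756). Closes only with a `_holds` (the whole paper + the IMC
inputs Kato / Skinner–Urban / Wan) or when the planner registers it as a route obligation.
[cite: Kim2022StructureSelmer, Thm. 1.11] -/
theorem stub_kimCertificate : Kim2022_kuriharaNumber_certificate := by
  sorry

/-! ### Composition -/

/-- **The crux from the two literature-debt stubs and finiteness of `Ш`**, by the landed
conditional composition `tamePinchR_of_facts` (p132014). [cite: Kim2022StructureSelmer, Thm. 1.11] -/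
theorem tamePinchR_of_shaFinite (hSha : ShaFiniteConjecture) : TamePinchR :=
  tamePinchR_of_facts stub_modularity stub_kimCertificate hSha

end Summit.BirchSwinnertonDyer.BirchSwinnertonDyer.Theorems

end
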